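import Literature.Geometry.Lorentzian.SurfaceTransgression
import Literature.Geometry.Lorentzian.GreenIdentityCompactSupport
import Mathlib.Geometry.Manifold.PartitionOfUnity
import HarnessLib

/-!
# Locality of the metric operators and of the Riemannian integral in the metric

Two smooth metrics which agree on an open set `U` have there the same gradient pairing, the same
Laplace–Beltrami operator and the same scalar curvature, and continuous functions supported in
`U` have the same integral against the two Riemannian measures. These bookkeeping facts (all
local computations "see" only the metric near the point; Chavel 2006, §III.3: `dV = √g dx` in a
chart) are what makes the modification of a metric near finitely many points harmless away from
them in the Gauss–Bonnet argument (the metric is flattened in Morse coordinates near the critical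
points, Chern 1944, §2). Contents (all proved, no definitions):

* coordinate level (`MetricCoord`): `sharpAt`, `chrAt`, `hessAt`, `lapAt`, `gradSqAt`, `riemAt`,
  `ricAt`, `scalAt` at `u` only depend on the germ of the components `G` at `u`
  (`…_congr_metric`, `lapAt_congr_metric_germ`);
* manifold level: for `g'.val = g.val` on an open `U ∋ x`: `innerDual`, `gradSq`, `dalembertian`,
  `scalarCurvature` agree at `x` (`…_eq_of_eqOn`), through the chart bridges of
  `BakryEmeryHeatFlow.lean` / `SurfaceTransgression.lean`;
* `integral_eq_of_inner_eqOn` — `∫ F dμ_{h'} = ∫ F dμ_h` for `F` continuous with compact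
  `tsupport F ⊆ U` (finite partition of unity subordinate to chart domains and the chart formula
  `integral_eq_integral_chart`, whose density `√det h_{ij}(y)` only involves the metric at
  `φ⁻¹ y`).

## References

* I. Chavel, *Riemannian Geometry: A Modern Introduction*, 2nd ed., CUP 2006, §III.3.
  [Chavel2006]
* S.-S. Chern, *A simple intrinsic proof of the Gauss–Bonnet formula for closed Riemannian
  manifolds*, Ann. of Math. 45 (1944), §2. [Chern1944]
-/

noncomputable section

set_option maxSynthPendingDepth 3

open Bundle Set Function Filter Module TopologicalSpace MeasureTheory Manifold
open scoped Manifold ContDiff Topology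

namespace Literature.Geometry.Lorentzian

/-! ### Coordinate level: the operators depend on the germ of the components -/

namespace MetricCoord

variable {E : Type*} [NormedAddCommGroup E] [NormedSpace ℝ E] {G G' : E → E →L[ℝ] E →L[ℝ] ℝ}
  {u : E}

/-- `♯` at `u` only depends on `G u`. [folklore] -/
theorem sharpAt_congr_metric (h : G u = G' u) : sharpAt G u = sharpAt G' u := by
  simp only [sharpAt, h]

/-- The Koszul form at `u` only depends on the germ of `G` at `u`. [folklore] -/
theorem koszulCLM_congr_metric (h : G =ᶠ[𝓝 u] G') : koszulCLM G u = koszulCLM G' u := by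
  simp only [koszulCLM, h.fderiv_eq]

/-- The Christoffel map at `u` only depends on the germ of `G` at `u`. [folklore] -/
theorem chrAt_congr_metric (h : G =ᶠ[𝓝 u] G') : chrAt G u = chrAt G' u := by
  simp only [chrAt, koszulCLM_congr_metric h, sharpAt_congr_metric h.eq_of_nhds]

/-- The Christoffel maps of two germ-equal components agree near the point. [folklore] -/
theorem chrAt_eventuallyEq (h : G =ᶠ[𝓝 u] G') : chrAt G =ᶠ[𝓝 u] chrAt G' := by
  filter_upwards [h.eventually_nhds] with y hy using chrAt_congr_metric hy

/-- The coordinate Hessian at `u` only depends on the germ of `G` at `u`. [folklore] -/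
theorem hessAt_congr_metric (h : G =ᶠ[𝓝 u] G') (F : E → ℝ) : hessAt G F u = hessAt G' F u := by
  simp only [hessAt, chrAt_congr_metric h]

/-- The metric trace at `u` only depends on `G u`. [folklore] -/
theorem mtrAt_congr_metric (h : G u = G' u) (β : E →L[ℝ] E →L[ℝ] ℝ) : mtrAt G u β = mtrAt G' u β := by
  simp only [mtrAt, sharpAt_congr_metric h]

/-- The coordinate Laplacian at `u` only depends on the germ of `G` at `u` (the tree's
`MetricCoord.lapAt_congr_metric` of `HarmonicallyFlatPotential.lean`, restated to avoid its
imports). [folklore] -/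
theorem lapAt_congr_metric_germ [FiniteDimensional ℝ E] (h : G =ᶠ[𝓝 u] G') (F : E → ℝ) :
    lapAt G F u = lapAt G' F u := by
  simp only [lapAt, hessAt_congr_metric h, mtrAt_congr_metric h.eq_of_nhds]

/-- The coordinate gradient square at `u` only depends on `G u`. [folklore] -/
theorem gradSqAt_congr_metric (h : G u = G' u) (F : E → ℝ) : gradSqAt G F u = gradSqAt G' F u := by
  simp only [gradSqAt, sharpAt_congr_metric h]

/-- The curvature endomorphism at `u` only depends on the germ of `G` at `u`. [folklore] -/
theorem riemAt_congr_metric (h : G =ᶠ[𝓝 u] G') (X Y : E) : riemAt G u X Y = riemAt G' u X Y := by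
  simp only [riemAt, (chrAt_eventuallyEq h).fderiv_eq, chrAt_congr_metric h]

/-- The Ricci form at `u` only depends on the germ of `G` at `u`. [folklore] -/
theorem ricAt_congr_metric [FiniteDimensional ℝ E] (h : G =ᶠ[𝓝 u] G') :
    ricAt G u = ricAt G' u := by
  ext Y Z
  simp only [ricAt_apply]
  congr 1
  ext X
  simp only [ricciEndo_apply, riemAt_congr_metric h]

/-- The coordinate scalar curvature at `u` only depends on the germ of `G` at `u`. [folklore] -/
theorem scalAt_congr_metric [FiniteDimensional ℝ E] (h : G =ᶠ[𝓝 u] G') :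
    scalAt G u = scalAt G' u := by
  simp only [scalAt, ricAt_congr_metric h, mtrAt_congr_metric h.eq_of_nhds]

end MetricCoord

/-! ### Manifold level: operators of two metrics agreeing on an open set -/

section Operators

open Literature.Geometry.Riemannian PseudoRiemannianMetric

variable {E : Type*} [NormedAddCommGroup E] [NormedSpace ℝ E] [FiniteDimensional ℝ E]
  [CompleteSpace E] {H : Type*} [TopologicalSpace H] {I : ModelWithCorners ℝ E H} [I.Boundaryless]
  {M : Type*} [TopologicalSpace M] [ChartedSpace H M] [IsManifold I ∞ M]
  (g g' : PseudoRiemannianMetric I ∞ E (TangentSpace I : M → Type _))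
  {U : Set M} (hU : IsOpen U) (hgg' : ∀ x ∈ U, g'.val x = g.val x)

include hgg' in
omit [CompleteSpace E] [I.Boundaryless] in
/-- `♯` of two metrics agreeing at `x` agree at `x`. [folklore] -/
theorem sharp_eq_of_eqOn {x : M} (hx : x ∈ U) (α : Module.Dual ℝ (TangentSpace I x)) :
    g'.sharp x α = g.sharp x α := by
  refine g'.sharp_eq_of_forall x α _ fun w ↦ ?_
  rw [hgg' x hx, g.val_sharp_apply]

include hgg' in
omit [CompleteSpace E] [I.Boundaryless] in
/-- **The pairing of differentials is pointwise in the metric.** [folklore] -/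
theorem innerDual_eq_of_eqOn {x : M} (hx : x ∈ U) (α β : Module.Dual ℝ (TangentSpace I x)) :
    g'.innerDual x α β = g.innerDual x α β := by
  simp only [innerDual, sharp_eq_of_eqOn g g' hgg' hx]

include hgg' in
omit [CompleteSpace E] [I.Boundaryless] in
/-- **The gradient square is pointwise in the metric.** [folklore] -/
theorem gradSq_eq_of_eqOn {x : M} (hx : x ∈ U) (F : M → ℝ) : g'.gradSq F x = g.gradSq F x :=
  innerDual_eq_of_eqOn g g' hgg' hx _ _

include hU hgg' in
omit [FiniteDimensional ℝ E] [CompleteSpace E] in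
/-- The chart representatives of two metrics agreeing on `U` agree near the chart image of a
point of `U`. [folklore] -/
theorem chartRep_eventuallyEq_of_eqOn (x₀ : M) (u : chartTarget I x₀) (hu : chartInv I x₀ u ∈ U) :
    chartRep I (fun _ ↦ g') x₀ 0 =ᶠ[𝓝 (u : E)] chartRep I (fun _ ↦ g) x₀ 0 := by
  have hc : ContinuousOn (extChartAt I x₀).symm (extChartAt I x₀).target :=
    continuousOn_extChartAt_symm x₀
  have hmem : (extChartAt I x₀).target ∩ (extChartAt I x₀).symm ⁻¹' U ∈ 𝓝 (u : E) :=
    (hc.isOpen_inter_preimage (isOpen_extChartAt_target x₀) hU).mem_nhds ⟨u.2, hu⟩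
  filter_upwards [hmem] with y hy
  ext a b
  simp only [chartRep, gramOpFamily, ContinuousLinearMap.bilinearComp_apply]
  rw [hgg' _ hy.2]

variable [g.HasLeviCivita] [g'.HasLeviCivita]

include hU hgg' in
omit [CompleteSpace E] in
/-- **The Laplace–Beltrami operator is local in the metric**: if `g' = g` on an open `U ∋ x` then
`Δ_{g'} F (x) = Δ_g F (x)` for `F` of class `C²` at `x`. [folklore] -/
theorem dalembertian_eq_of_eqOn {x : M} (hx : x ∈ U) {F : M → ℝ}
    (hF : ContMDiffAt I 𝓘(ℝ, ℝ) 2 F x) : g'.dalembertian F x = g.dalembertian F x := by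
  have hxs : x ∈ (chartAt H x).source := mem_chart_source H x
  set u : chartTarget I x := ⟨extChartAt I x x, (extChartAt I x).map_source (by rwa [extChartAt_source])⟩
  have hux : chartInv I x u = x := chartInv_extChartAt x hxs
  have hF' : ContMDiffAt I 𝓘(ℝ, ℝ) 2 F (chartInv I x u) := by rwa [hux]
  have h1 := dalembertian_chartInv_eq g' x u hF'
  have h2 := dalembertian_chartInv_eq g x u hF'
  rw [hux] at h1 h2
  rw [h1, h2]
  exact MetricCoord.lapAt_congr_metric_germ (chartRep_eventuallyEq_of_eqOn g g' hU hgg' x u (hux.symm ▸ hx)) _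

include hU hgg' in
/-- **The scalar curvature is local in the metric**: if `g' = g` on an open `U ∋ x` then
`S_{g'}(x) = S_g(x)`. [folklore] -/
theorem scalarCurvature_eq_of_eqOn {x : M} (hx : x ∈ U) : g'.scalarCurvature x = g.scalarCurvature x := by
  have hxs : x ∈ (chartAt H x).source := mem_chart_source H x
  set u : chartTarget I x := ⟨extChartAt I x x, (extChartAt I x).map_source (by rwa [extChartAt_source])⟩
  have hux : chartInv I x u = x := chartInv_extChartAt x hxs
  have h1 := scalarCurvature_chartInv_eq g' x u
  have h2 := scalarCurvature_chartInv_eq g x u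
  rw [hux] at h1 h2
  rw [h1, h2]
  exact MetricCoord.scalAt_congr_metric (chartRep_eventuallyEq_of_eqOn g g' hU hgg' x u (hux.symm ▸ hx))

end Operators

/-! ### The Riemannian integral of a function supported where two metrics agree -/

section Measure

variable {m : ℕ} {H : Type*} [TopologicalSpace H]
  {I : ModelWithCorners ℝ (EuclideanSpace ℝ (Fin m)) H} [I.Boundaryless]
  {N : Type*} [TopologicalSpace N] [ChartedSpace H N] [IsManifold I ∞ N]
  [T2Space N] [LocallyCompactSpace N] [SigmaCompactSpace N] [MeasurableSpace N] [BorelSpace N]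
  (h h' : ContMDiffRiemannianMetric I ∞ (EuclideanSpace ℝ (Fin m)) (TangentSpace I : N → Type _))
  {U : Set N} (hU : IsOpen U) (hhh' : ∀ x ∈ U, h'.inner x = h.inner x)

include hhh' in
/-- For a function supported in one chart domain and in `U`, the two chart integrals agree: the
density `√det h_{ij}(y)` only involves the metric at `φ⁻¹ y`. [cite: Chavel2006, §III.3 (III.3.6)] -/
theorem integral_eq_of_inner_eqOn_of_support_subset [IsManifold I 1 N] (x : N) {F : N → ℝ}
    (hF : Measurable F) (hsupp : support F ⊆ (extChartAt I x).source) (hFU : support F ⊆ U) :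
    ∫ p, F p ∂riemannianMeasure h' = ∫ p, F p ∂riemannianMeasure h := by
  haveI : T3Space N := inferInstance
  rw [integral_eq_integral_chart h' x hF hsupp, integral_eq_integral_chart h x hF hsupp]
  refine setIntegral_congr_fun (isOpen_extChartAt_target x).measurableSet fun y _ ↦ ?_
  by_cases hy : F ((extChartAt I x).symm y) = 0
  · simp only [hy, smul_zero]
  · have hyU : (extChartAt I x).symm y ∈ U := hFU (mem_support.2 hy)
    have hdet : chartGramMatrix h' x y = chartGramMatrix h x y := by
      ext i j
      simp only [chartGramMatrix, Matrix.of_apply, hhh' _ hyU]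
    rw [hdet]

include hhh' in
/-- **The Riemannian integral of a function supported where two metrics agree is the same for
both metrics**: for `F` continuous with compact `tsupport F ⊆ U` and `h' = h` on the open set `U`,
`∫ F dμ_{h'} = ∫ F dμ_h` (finite partition of unity subordinate to chart domains on the compact
support, and the chart formula `∫ u dμ_h = ∫ √det h_{ij} · u ∘ φ⁻¹ dy`, Chavel 2006, (III.3.6)).
[cite: Chavel2006, §III.3 (III.3.6)] -/
theorem integral_eq_of_inner_eqOn {F : N → ℝ} (hFc : Continuous F) (hFs : HasCompactSupport F)
    (hFU : tsupport F ⊆ U) :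
    ∫ p, F p ∂riemannianMeasure h' = ∫ p, F p ∂riemannianMeasure h := by
  classical
  haveI : IsManifold I 1 N := IsManifold.of_le (n := ∞) (WithTop.coe_le_coe.mpr le_top)
  -- a finite cover of the compact support by chart domains and a subordinate partition of unity
  set K := tsupport F with hK
  have hKc : IsCompact K := hFs
  obtain ⟨t, -, ht⟩ := hKc.elim_nhds_subcover (fun x : N ↦ (chartAt H x).source)
    (fun x _ ↦ (chartAt H x).open_source.mem_nhds (mem_chart_source H x))
  obtain ⟨ρ, hρ⟩ := SmoothPartitionOfUnity.exists_isSubordinate I hKc.isClosed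
    (fun i : t ↦ (chartAt H (i : N)).source) (fun i ↦ (chartAt H (i : N)).open_source) (by
      intro p hp
      have hp' : p ∈ ⋃ x ∈ t, (chartAt H x).source := ht hp
      simp only [mem_iUnion] at hp' ⊢
      obtain ⟨x, hx, hpx⟩ := hp'
      exact ⟨⟨x, hx⟩, hpx⟩)
  have hsum : ∀ p ∈ K, ∑ i, ρ i p = 1 := fun p hp ↦ by
    rw [← finsum_eq_sum_of_fintype]
    exact ρ.sum_eq_one hp
  -- `F = ∑ ρᵢ F`
  have hFsum : ∀ p, F p = ∑ i, ρ i p * F p := by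
    intro p
    by_cases hp : p ∈ K
    · rw [← Finset.sum_mul, hsum p hp, one_mul]
    · rw [image_eq_zero_of_notMem_tsupport hp]
      simp
  have hpc : ∀ i, Continuous fun p ↦ ρ i p * F p := fun i ↦ (ρ i).contMDiff.continuous.mul hFc
  have hpsupp : ∀ i, support (fun p ↦ ρ i p * F p) ⊆ (extChartAt I (i : N)).source := fun i ↦ by
    rw [extChartAt_source]
    exact (support_mul_subset_left _ _).trans ((subset_tsupport _).trans (hρ i))
  have hpU : ∀ i, support (fun p ↦ ρ i p * F p) ⊆ U := fun i ↦
    (support_mul_subset_right _ _).trans ((subset_tsupport F).trans hFU)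
  have hpiece : ∀ i, ∫ p, ρ i p * F p ∂riemannianMeasure h' = ∫ p, ρ i p * F p ∂riemannianMeasure h :=
    fun i ↦ integral_eq_of_inner_eqOn_of_support_subset h h' hhh' (i : N) (hpc i).measurable
      (hpsupp i) (hpU i)
  -- integrability of the pieces (continuous with compact support)
  have hpint : ∀ (k : ContMDiffRiemannianMetric I ∞ (EuclideanSpace ℝ (Fin m)) (TangentSpace I : N → Type _))
      i, Integrable (fun p ↦ ρ i p * F p) (riemannianMeasure k) := by
    intro k i
    have hcs : HasCompactSupport fun p ↦ ρ i p * F p := hFs.mul_left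
    haveI : IsFiniteMeasureOnCompacts (riemannianMeasure k) :=
      ⟨fun K hK ↦ riemannianVolume_lt_top_of_isCompact_holds k le_rfl hK⟩
    exact (hpc i).integrable_of_hasCompactSupport hcs
  calc ∫ p, F p ∂riemannianMeasure h'
      = ∫ p, ∑ i, ρ i p * F p ∂riemannianMeasure h' := integral_congr_ae (Eventually.of_forall hFsum)
    _ = ∑ i, ∫ p, ρ i p * F p ∂riemannianMeasure h' := integral_finsetSum _ fun i _ ↦ hpint h' i
    _ = ∑ i, ∫ p, ρ i p * F p ∂riemannianMeasure h := Finset.sum_congr rfl fun i _ ↦ hpiece i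
    _ = ∫ p, ∑ i, ρ i p * F p ∂riemannianMeasure h := (integral_finsetSum _ fun i _ ↦ hpint h i).symm
    _ = ∫ p, F p ∂riemannianMeasure h := integral_congr_ae (Eventually.of_forall fun p ↦ (hFsum p).symm)

end Measure

end Literature.Geometry.Lorentzian

end
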